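import Summits.BirchSwinnertonDyer.Rank1Residual.Additive.KatoDescentPerrinRiouRatioUnit
import Summits.BirchSwinnertonDyer.Rank1Residual.Additive.KatoDescentKatoRigidOfAugmentation
import HarnessLib

set_option autoImplicit false

/-!
# PR-INV ⟸ {lev, Kato Thm. 12.4 (2), AUG}, by name: the display PR-INV of stub 3 of the Kato–Perrin-Riou skeletons from
# `IsNewformOf.level_eq_conductorNorm`, the named fact `Kato2004.thm12_4` and the augmentation display AUG
# (seat `bsd-cm-prr-ty1` g14, cell `bsd-cm`; one theorem: no definition, no named fact, no instance, no `sorry`)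

Part 42 of the seat's kernel cut of stub 3 (cruxes stmt-BirchSwinnertonDyer-19945 / -19223): the one-line composite of Part 40
(E27 `prInv_of_lev_of_katoRigid`: PR-INV ⟸ {lev, KATO-RIGID}, UNIT proved) and Part 41 (E28 `katoRigid_of_thm12_4_of_aug`:
KATO-RIGID ⟸ {thm12_4, AUG}), stated so that consumers read the lane's residual BY NAME:
**`prInv_of_lev_of_thm12_4_of_aug (hlev) (h12 : Kato2004.thm12_4) (hAUG : ⟨AUG⟩) : ⟨PR-INV = A2's hPRinv, verbatim⟩`.**
READING OF RECORD after Parts 38–42: the display PR-INV (the `ℤ_pˣ`-rigidity of the closed Perrin-Riou ratio `Kato2004.PRRatio`)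
⟸ {`IsNewformOf.level_eq_conductorNorm` (multiplicity one / level = conductor, named fact), `Kato2004.thm12_4` (Kato Thm. 12.4 (2),
named fact), AUG (display: Kato §13.9 p. 230 «computing the images of these elements under (13.7.1) by using Thm 6.6 and Thm 9.7»,
read at the trivial character for the Λ-collinearity coefficients of the two lifted families — the character-wise comparison of
the two `ZetaBody` value laws (C5), Rohrlich's non-vanishing, Weierstrass preparation and the coherence of the embedding twists;
NOT proved)}.  HONEST LABEL: no stub is closed; nothing is asserted on 19945 / 19223; no summit statement is proved;
Perrin-Riou's conjecture and Kato's Main Conjecture are untouched; BSD is not proved for any curve.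
References: [Kato2004Asterisque] Thm. 12.4 (2) (p. 221), §13.9–Lemma 13.10 (pp. 229–230); [BlochKato1990] Prop. 3.8, Ex. 3.11.
-/

noncomputable section

open scoped Classical NumberField BigOperators TensorProduct

open WeierstrassCurve Field IsDedekindDomain NumberField Rat.HeightOneSpectrum CongruenceSubgroup ValuativeRel
  Literature.NumberTheory.EllipticCurves Literature.NumberTheory.EllipticCurves.ModularForms
  Literature.NumberTheory.EllipticCurves.Rank1Residual Literature.NumberTheory.EllipticCurves.Rank1Residual.Typed
  Literature.NumberTheory.EllipticCurves.Kato2004 Literature.NumberTheory.EllipticCurves.IwasawaAlgebra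
  Literature.NumberTheory.EllipticCurves.Kato2004.EulerSystemValues
  Literature.NumberTheory.GaloisRepresentations Literature.NumberTheory.GaloisRepresentations.PeriodRingData
  Literature.NumberTheory.GaloisRepresentations.IsNonarchimedeanLocalField Literature.NumberTheory.PAdicHodge
  Literature.NumberTheory.AdelicBaseChange Literature.NumberTheory.Automorphic
open Summit.BirchSwinnertonDyer.BirchSwinnertonDyer.Theorems.CongruentShaFreeCutKatoKummerLogTorsion
open Summit.BirchSwinnertonDyer.Rank1Residual Summit.BirchSwinnertonDyer.Rank1Residual.Additive

namespace Summit.BirchSwinnertonDyer.Rank1Residual.Additive.PerrinRiouUnit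

set_option backward.isDefEq.respectTransparency false in
/-- **PR-INV ⟸ {lev, thm12_4, AUG}** (E27 `prInv_of_lev_of_katoRigid` ∘ E28 `katoRigid_of_thm12_4_of_aug`): the display PR-INV of
stub 3 (A2's `hPRinv`, verbatim) from `IsNewformOf.level_eq_conductorNorm`, Kato's Thm. 12.4 (2) (`Kato2004.thm12_4`, a named
fact, hypothesis `h12`) and the display AUG (`hAUG`, E28's binder verbatim).  AUG is DISPLAYED, not proved; no stub is closed;
nothing is asserted on 19945 / 19223; BSD is not proved for any curve.
[cite: Kato2004Asterisque, Thm. 12.4 (2) (p. 221) and §13.9–Lemma 13.10 (pp. 229–230)] [cite: BlochKato1990, Prop. 3.8 and Ex. 3.11] -/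
theorem prInv_of_lev_of_thm12_4_of_aug
    (hlev : ∀ (N : ℕ) [NeZero N], IsNewformOf.level_eq_conductorNorm (N := N)) (h12 : Kato2004.thm12_4)
    (hAUG : ∀ (W : WeierstrassCurve ℚ) [W.IsElliptic] [W.IsGloballyMinimal] (p : ℕ) [Fact p.Prime],
      letI : ContinuousSMul ℤ_[p] (W.tateModule p) := TateModule.continuousSMul_padicInt
      letI : Module.Free ℤ_[p] (W.tateModule p) := W.module_free_tateModule_holds p
      letI : Module.Finite ℤ_[p] (W.tateModule p) := W.module_finite_tateModule_holds p
      ∀ (hp : p ≠ 2) {N : ℕ} [NeZero N] (f : CuspForm (Gamma0 N) 2), IsNewformOf W f →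
      ∀ (ι₁ ι₂ : (n : ℕ) → (CyclotomicField n ℚ →+* ℂ)) (q₁ q₂ : ℚ)
        (Λ₁ Λ₂ : ∀ (k : ℕ) (r : Finset (HeightOneSpectrum (𝓞 ℚ))),
          H1 (tateRep W p) (cycSubgroup p k r) →ₗ[ℤ_[p]] ℚ_[p] ⊗[ℚ] CyclotomicField (cycLevel p k r) ℚ) (e : ℚ_[p]),
        q₁ ≠ 0 → q₂ ≠ 0 → e ≠ 0 → (∀ (k : ℕ) (y : H1 (tateRep W p) (cycSubgroup p k ∅)), Λ₂ k ∅ y = e • Λ₁ k ∅ y) →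
      ∀ (c₁ d₁ a₁ : ℤ) (A₁ : ℕ) (d'₁ : ℤ) (c₂ d₂ a₂ : ℤ) (A₂ : ℕ) (d'₂ : ℤ),
        0 < A₁ → Int.gcd c₁ (6 * p * A₁) = 1 → Int.gcd d₁ (6 * p * N) = 1 → (d₁ : ℤ) * d'₁ ≡ 1 [ZMOD (A₁ : ℤ)] →
        ratCuspFactor f true c₁ d₁ a₁ A₁ d'₁ ≠ 0 →
        0 < A₂ → Int.gcd c₂ (6 * p * A₂) = 1 → Int.gcd d₂ (6 * p * N) = 1 → (d₂ : ℤ) * d'₂ ≡ 1 [ZMOD (A₂ : ℤ)] →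
        ratCuspFactor f true c₂ d₂ a₂ A₂ d'₂ ≠ 0 →
      ∀ (z₁ : ∀ (k : ℕ) (r : (cyclotomicLevelsRat p (badPlaces c₁ d₁ A₁ N)).Ideals),
          H1 (tateRep W p) ((cyclotomicLevelsRat p (badPlaces c₁ d₁ A₁ N)).level k r.1))
        (x₁ : ∀ (k : ℕ) (r : (cyclotomicLevelsRat p (badPlaces c₁ d₁ A₁ N)).Ideals), CyclotomicField (cycLevel p k r.1) ℚ),
        ZetaBody W p f ι₁ ((q₁ : ℚ) : ℝ) Λ₁ c₁ d₁ a₁ A₁ z₁ x₁ →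
      ∀ (z₂ : ∀ (k : ℕ) (r : (cyclotomicLevelsRat p (badPlaces c₂ d₂ A₂ N)).Ideals),
          H1 (tateRep W p) ((cyclotomicLevelsRat p (badPlaces c₂ d₂ A₂ N)).level k r.1))
        (x₂ : ∀ (k : ℕ) (r : (cyclotomicLevelsRat p (badPlaces c₂ d₂ A₂ N)).Ideals), CyclotomicField (cycLevel p k r.1) ℚ),
        ZetaBody W p f ι₂ ((q₂ : ℚ) : ℝ) Λ₂ c₂ d₂ a₂ A₂ z₂ x₂ →
      ∀ (K : ZpExtension ℚ p) (hK : K.IsCyclotomic) (γ : absoluteGaloisGroup ℚ), K.IsTopGenerator γ →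
      ∀ (I : IwasawaH1Data W p K γ) (y₁ y₂ : I.H),
        (∀ n : ℕ, I.proj n y₁ = levelToLayer W p hK hp (badPlaces c₁ d₁ A₁ N) n
          (z₁ (n + 1) (cyclotomicLevelsRat p (badPlaces c₁ d₁ A₁ N)).idealOne)) →
        (∀ n : ℕ, I.proj n y₂ = levelToLayer W p hK hp (badPlaces c₂ d₂ A₂ N) n
          (z₂ (n + 1) (cyclotomicLevelsRat p (badPlaces c₂ d₂ A₂ N)).idealOne)) →
      ∀ (F G : IwasawaAlgebra p), F • y₁ = G • y₂ →
        (PowerSeries.constantCoeff F ≠ 0 ∨ PowerSeries.constantCoeff G ≠ 0) →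
        e * ((q₁ * ratCuspFactor f true c₁ d₁ a₁ A₁ d'₁ * ∏ ℓ ∈ (p * A₁).primeFactors, eulerFactorAtOne W N ℓ : ℚ) : ℚ_[p]) * ((PowerSeries.constantCoeff F : ℤ_[p]) : ℚ_[p]) =
          ((q₂ * ratCuspFactor f true c₂ d₂ a₂ A₂ d'₂ * ∏ ℓ ∈ (p * A₂).primeFactors, eulerFactorAtOne W N ℓ : ℚ) : ℚ_[p]) * ((PowerSeries.constantCoeff G : ℤ_[p]) : ℚ_[p])) :
    ∀ (W : WeierstrassCurve ℚ) [W.IsElliptic] [W.IsGloballyMinimal] (p : ℕ) [Fact p.Prime]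
      (ℒ₁ ℒ₂ : ℚ_[p]), Kato2004.PRRatio W p ℒ₁ → Kato2004.PRRatio W p ℒ₂ → ∃ w : ℚ_[p], ‖w‖ = 1 ∧ ℒ₂ = w * ℒ₁ :=
  prInv_of_lev_of_katoRigid hlev (katoRigid_of_thm12_4_of_aug h12 hAUG)

end Summit.BirchSwinnertonDyer.Rank1Residual.Additive.PerrinRiouUnit

end
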